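import Literature.Topology.FourManifolds.MMSWFibreRotation
import Literature.Analysis.SpecialFunctions.PeriodicArgComp
import HarnessLib

/-!
# The strip twist of the model `M_r`: full twists inserted across thin vertical bands

Sibling of `MMSWMembraneTwist.lean`, towards the named fact
`Literature.Topology.FourManifolds.MMSW.eventually_approxHasRasmussen` (Manolescu–Marengon–
Sarkar–Willis, Duke Math. J. 172 (2023), arXiv:1910.08195, Thm. 1.4 / Prop. 8.2 (i)).

`MMSWMembraneTwist` concentrates the `k` full twists of the spread-out sphere twist `σ^k` into thin
WEDGES about the upward rays `γ_j` from the hole centres; its phase depends on the direction of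
`z - c_j`, so in the standard (annular) picture — planar radius `Re z + C_r`, angle `-arg w`,
height `Im z` — a strand crossing the wedge at height `y` becomes a `k`-turn spiral of radial
width `∝ y`, and spirals of different strands cross.  This file uses instead thin vertical BANDS
`{|Re z - c_j| < w, Im z > 0}` (`0 < w < 1`; their lower edges lie inside the holes) with a phase
depending on `Re z - c_j` only:

* `stripPhase w ζ = -2π S((Re ζ + w)/2w)` if `Im ζ > 0`, `0` otherwise (`S = Real.smoothTransition`):
  real-valued it jumps only across `{Im ζ = 0, |Re ζ| < w} ⊆ {|ζ| < 1}` (in the hole) and by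
  exactly `-2π` across `{Im ζ = 0, Re ζ ≥ w}`, so `stripUnit k w ζ = e^{i k stripPhase}` is a
  smooth unit on `{|ζ| ≥ 1}`, equal to `1` off the band, of winding number `k` about `0`;
* `stripLog w ζ = stripPhase w ζ - (arg(-ζ) + π)` is a SMOOTH real function on `{|ζ| ≥ 1}`
  (`contDiffAt_stripLog`: the jumps of `stripPhase` and of the argument branch `arg(-ζ) + π`
  (cut along the positive real axis) cancel), with `e^{i k stripLog} = stripUnit · u^{-k}`,
  `u(ζ) = ζ/|ζ|` (`exp_mul_stripLog`);
* `stripFamily r k w a z = u(z)^k · e^{i a k Σ_j stripLog (z - c_j)}` is therefore a smooth family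
  of unit multipliers from `u^k` (`a = 0`) to the **strip multiplier**
  `Π_j stripUnit k w (z - c_j)` (`a = 1`, `stripFamily_one`), and
  `stripTwist r k w = fibreRot (stripMultiplier r k w)` is the identity off the bands
  (`stripTwist_eq_self`).

Consequences, exactly as for the membrane twist (`MMSWFibreRotation`: a smooth family of unit
multipliers from `u^k` is an isotopy of model knots from `σ^k ∘ K`): `s₋` and `s₊` are invariant
under the strip twist (`hasSMinus_stripTwist_comp_iff`, `hasSPlus_stripTwist_comp_iff`; MMSW
Thm. 2.8 for these Dehn twists), and for a core-missing model knot the Rasmussen invariants of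
`D(k⃗ + j⃗)(K)` are those of `D(j⃗)(stripTwist r k w ∘ K)` (`approxHasRasmussen_iff_stripTwist`).
The point of the bands: in the picture every strand crossing band `j` above the hole becomes a
`k`-turn spiral of the SAME radial profile, so distinct strands give nested disjoint spirals and
the Gauss diagram of `D(0⃗)(stripTwist_k ∘ K)` differs from that of `D(0⃗)(K)` only by `k` rounds of
crossings of these spirals over the strands crossing the line `Re z = c_j` below the hole — the
explicit form of MMSW's `D(k⃗)` in the tree's picture (to be read off in a sequel).  In `S³` the
band membrane closes up at the north pole to the disc spanned by the top circle of the `j`-th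
dotted circle's tube, and the strip twist is `k` full twists of the strands through that disc.

Everything is proved; no named facts; definitions: `bandStep`, `stripPhase`, `stripUnit`,
`stripLog`, `stripFamily`, `stripMultiplier`, `stripTwist`, and — for bands displaced to
`c_j + e_j`, `|e_j| + w < 1` (section "Offset bands") — `stripFamilyAt`, `stripMultiplierAt`,
`stripTwistAt`.

## References

* C. Manolescu, M. Marengon, S. Sarkar, M. Willis, Duke Math. J. 172 (2023) 231–311,
  arXiv:1910.08195, §2.1 (Fig. InsertTwists), §2.3 (Thm. 2.8), Prop. 8.2 and §8.1.
  [ManolescuMarengonSarkarWillis2023]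
* R. Kirby, *The Topology of 4-Manifolds*, LNM 1374 (1989), Ch. I §2. [Kirby1989]
-/

open scoped Manifold ContDiff Topology ComplexConjugate Real
open Function Set Complex

noncomputable section

namespace Literature.Topology.FourManifolds

/-- Local notation: `𝔼 n` is the model Euclidean space `EuclideanSpace ℝ (Fin n)`. -/
local notation "𝔼 " n:arg => EuclideanSpace ℝ (Fin n)

/-- Local notation: `𝕊 n` is the unit sphere in `EuclideanSpace ℝ (Fin (n + 1))`. -/
local notation "𝕊 " n:arg => (Metric.sphere (0 : EuclideanSpace ℝ (Fin (n + 1))) 1)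

namespace MMSW

open Literature.AlgebraicTopology.Homotopy.HopfFibration (zC wC ofZW zC_ofZW wC_ofZW ofZW_zC_wC)
open Literature.Analysis.SpecialFunctions (contDiffAt_arg_of_mem_slitPlane)

variable {r : ℕ}

/-! ## The band step and the strip phase -/

/-- The smooth step across the band `[-w, w]`: `S((x + w)/2w)`, `0` for `x ≤ -w`, `1` for `x ≥ w`.
[folklore] -/
def bandStep (w x : ℝ) : ℝ :=
  Real.smoothTransition ((x + w) / (2 * w))

/-- The band step vanishes left of the band. [folklore] -/
theorem bandStep_of_le_neg {w x : ℝ} (hw : 0 < w) (hx : x ≤ -w) : bandStep w x = 0 :=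
  Real.smoothTransition.zero_of_nonpos (div_nonpos_of_nonpos_of_nonneg (by linarith) (by linarith))

/-- The band step is `1` right of the band. [folklore] -/
theorem bandStep_of_le {w x : ℝ} (hw : 0 < w) (hx : w ≤ x) : bandStep w x = 1 :=
  Real.smoothTransition.one_of_one_le ((one_le_div (by linarith)).2 (by linarith))

/-- The band step is smooth. [folklore] -/
theorem contDiff_bandStep (w : ℝ) : ContDiff ℝ ∞ (bandStep w) :=
  Real.smoothTransition.contDiff.comp ((contDiff_id.add contDiff_const).div_const _)

/-- **The strip phase** (real representative of the circle-valued band phase):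
`-2π S((Re ζ + w)/2w)` on the open upper half-plane, `0` on the closed lower half-plane.
[folklore] -/
def stripPhase (w : ℝ) (ζ : ℂ) : ℝ :=
  if 0 < ζ.im then -(2 * π * bandStep w ζ.re) else 0

/-- **The strip unit** `e^{i k · stripPhase}`: `k` full turns across the band above the hole, `1`
elsewhere. [folklore] -/
def stripUnit (k : ℤ) (w : ℝ) (ζ : ℂ) : ℂ :=
  exp (((k * stripPhase w ζ : ℝ) : ℂ) * I)

/-- The strip unit has modulus one. [folklore] -/
theorem norm_stripUnit (k : ℤ) (w : ℝ) (ζ : ℂ) : ‖stripUnit k w ζ‖ = 1 :=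
  Complex.norm_exp_ofReal_mul_I _

/-- `e^{2πi n} = 1` for an integer `n`, in the form `exp ((n * (2π)) i) = 1`. [folklore] -/
theorem exp_int_mul_two_pi_mul_I' (n : ℤ) : exp (((n * (2 * π) : ℝ) : ℂ) * I) = 1 := by
  have h := Complex.exp_int_mul_two_pi_mul_I n
  push_cast at h ⊢
  rwa [mul_assoc]

/-- **The strip unit is `1` off the band**: on the closed lower half-plane, and where
`|Re ζ| ≥ w`. [folklore] -/
theorem stripUnit_eq_one {k : ℤ} {w : ℝ} (hw : 0 < w) {ζ : ℂ}
    (h : ζ.im ≤ 0 ∨ w ≤ |ζ.re|) : stripUnit k w ζ = 1 := by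
  unfold stripUnit stripPhase
  by_cases him : 0 < ζ.im
  · rw [if_pos him]
    have hre : w ≤ |ζ.re| := h.resolve_left (not_le.2 him)
    rcases le_abs'.1 hre with hle | hle
    · rw [bandStep_of_le_neg hw hle]
      simp
    · rw [bandStep_of_le hw hle, mul_one, show ((k : ℝ) * -(2 * π)) = ((-k : ℤ) : ℝ) * (2 * π) by
        push_cast; ring]
      exact exp_int_mul_two_pi_mul_I' (-k)
  · rw [if_neg him]
    simp

/-! ## The smooth logarithm of `stripUnit · u^{-1}` -/

/-- **The strip logarithm** `stripPhase w ζ - (arg(-ζ) + π)`: the strip phase minus the branch of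
the argument of `ζ` cut along the positive real axis. [folklore] -/
def stripLog (w : ℝ) (ζ : ℂ) : ℝ :=
  stripPhase w ζ - (arg (-ζ) + π)

/-- `e^{i(arg(-ζ) + π)} = ζ/|ζ|`. [folklore] -/
theorem exp_arg_neg_add_pi_mul_I {ζ : ℂ} (hζ : ζ ≠ 0) :
    exp (((arg (-ζ) + π : ℝ) : ℂ) * I) = ζ / ((‖ζ‖ : ℝ) : ℂ) := by
  have h := Complex.norm_mul_exp_arg_mul_I (-ζ)
  rw [norm_neg] at h
  have hn : ((‖ζ‖ : ℝ) : ℂ) ≠ 0 := by exact_mod_cast norm_ne_zero_iff.2 hζ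
  rw [Complex.ofReal_add, add_mul, Complex.exp_add, Complex.exp_pi_mul_I, eq_div_iff hn, mul_comm,
    ← mul_assoc, h, mul_neg_one, neg_neg]

/-- **`e^{i k stripLog} = stripUnit · u^{-k}`**, `u = ζ/|ζ|`. [folklore] -/
theorem exp_mul_stripLog {ζ : ℂ} (hζ : ζ ≠ 0) (k : ℤ) (w : ℝ) :
    exp (((k * stripLog w ζ : ℝ) : ℂ) * I) = stripUnit k w ζ * (ζ / ((‖ζ‖ : ℝ) : ℂ)) ^ (-k) := by
  rw [stripLog, mul_sub, Complex.ofReal_sub, sub_mul, Complex.exp_sub, stripUnit, zpow_neg,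
    div_eq_mul_inv]
  congr 1
  rw [← exp_arg_neg_add_pi_mul_I hζ, ← Complex.exp_int_mul, Complex.ofReal_mul]
  push_cast
  ring_nf

/-- **The strip logarithm is smooth off the hole** (`0 < w < 1`, `|ζ| ≥ 1`).  Four zones: on the
open upper half-plane both terms are smooth; on the open lower half-plane the phase is `0`; near
the positive real axis `stripLog = -2π - arg ζ` (the two jumps cancel); near the negative real
axis `stripLog = -(arg(-ζ) + π)`. [folklore] -/
theorem contDiffAt_stripLog {w : ℝ} (hw : 0 < w) (hw1 : w < 1) {ζ : ℂ} (hζ : 1 ≤ ‖ζ‖) :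
    ContDiffAt ℝ ∞ (stripLog w) ζ := by
  have hband : ContDiff ℝ ∞ fun η : ℂ ↦ -(2 * π * bandStep w η.re) :=
    (contDiff_const.mul ((contDiff_bandStep w).comp Complex.reCLM.contDiff)).neg
  have hargneg : ∀ {η : ℂ}, -η ∈ slitPlane → ContDiffAt ℝ ∞ (fun η : ℂ ↦ arg (-η) + π) η :=
    fun h ↦ ((contDiffAt_arg_of_mem_slitPlane h).comp _ contDiff_neg.contDiffAt).add contDiffAt_const
  rcases lt_trichotomy ζ.im 0 with him | him | him
  · -- open lower half-plane: `stripLog = -(arg(-η) + π)` nearby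
    have hev : stripLog w =ᶠ[𝓝 ζ] fun η ↦ -(arg (-η) + π) := by
      filter_upwards [(isOpen_lt Complex.continuous_im continuous_const).mem_nhds him] with η hη
      rw [stripLog, stripPhase, if_neg (not_lt.2 (le_of_lt hη)), zero_sub]
    refine ContDiffAt.congr_of_eventuallyEq ?_ hev
    exact (hargneg (by rw [Complex.mem_slitPlane_iff]; right; simp [him.ne])).neg
  · -- on the real axis: `ζ.re ≠ 0`, indeed `|ζ.re| ≥ 1 > w`
    have hre : ‖ζ‖ = |ζ.re| := by
      rw [Complex.norm_eq_sqrt_sq_add_sq, him]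
      simp [Real.sqrt_sq_eq_abs]
    rcases lt_or_gt_of_ne (show ζ.re ≠ 0 from fun h0 ↦ by
      rw [hre, h0, abs_zero] at hζ; exact absurd hζ (by norm_num)) with hneg | hpos
    · -- near the negative real axis: `stripLog = -(arg(-η) + π)` on `{Re η < -w}`
      have hlt : ζ.re < -w := by
        rw [hre, abs_of_neg hneg] at hζ
        linarith
      have hev : stripLog w =ᶠ[𝓝 ζ] fun η ↦ -(arg (-η) + π) := by
        filter_upwards [(isOpen_lt Complex.continuous_re continuous_const).mem_nhds hlt] with η hη
        rw [stripLog, stripPhase]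
        by_cases hi : 0 < η.im
        · rw [if_pos hi, bandStep_of_le_neg hw hη.le]
          ring
        · rw [if_neg hi, zero_sub]
      refine ContDiffAt.congr_of_eventuallyEq ?_ hev
      exact (hargneg (by rw [Complex.mem_slitPlane_iff]; left; simp; linarith)).neg
    · -- near the positive real axis: `stripLog = -2π - arg η` on `{w < Re η}`
      have hlt : w < ζ.re := by
        rw [hre, abs_of_pos hpos] at hζ
        linarith
      have hev : stripLog w =ᶠ[𝓝 ζ] fun η ↦ -(2 * π) - arg η := by
        filter_upwards [(isOpen_lt continuous_const Complex.continuous_re).mem_nhds hlt] with η hη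
        rw [stripLog, stripPhase]
        rcases lt_trichotomy η.im 0 with hi | hi | hi
        · rw [if_neg (not_lt.2 hi.le), Complex.arg_neg_eq_arg_add_pi_of_im_neg hi]
          ring
        · have hη' : η = ((η.re : ℝ) : ℂ) := by
            apply Complex.ext <;> simp [hi]
          have hpos' : 0 < η.re := lt_trans hw hη
          rw [if_neg (by rw [hi]; exact lt_irrefl 0), hη', ← Complex.ofReal_neg,
            Complex.arg_ofReal_of_neg (by linarith), Complex.arg_ofReal_of_nonneg hpos'.le]
          ring
        · rw [if_pos hi, bandStep_of_le hw hη.le, Complex.arg_neg_eq_arg_sub_pi_of_im_pos hi]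
          ring
      refine ContDiffAt.congr_of_eventuallyEq ?_ hev
      exact contDiffAt_const.sub (contDiffAt_arg_of_mem_slitPlane
        (by rw [Complex.mem_slitPlane_iff]; left; linarith))
  · -- open upper half-plane: both terms smooth
    have hev : stripLog w =ᶠ[𝓝 ζ] fun η ↦ -(2 * π * bandStep w η.re) - (arg (-η) + π) := by
      filter_upwards [(isOpen_lt continuous_const Complex.continuous_im).mem_nhds him] with η hη
      rw [stripLog, stripPhase, if_pos hη]
    refine ContDiffAt.congr_of_eventuallyEq ?_ hev
    exact hband.contDiffAt.sub (hargneg (by rw [Complex.mem_slitPlane_iff]; right; simp [him.ne']))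

/-! ## The strip family and the strip twist -/

/-- **The strip family of multipliers** `Φ_a(z) = u(z)^k · e^{i a k Σ_j stripLog (z - c_j)}`, from
`Φ₀ = u^k` (the spread-out twist `σ^k`) to the strip multiplier `Φ₁` (`stripFamily_one`).
[folklore] -/
def stripFamily (r : ℕ) (k : ℤ) (w : ℝ) (a : ℝ) (z : ℂ) : ℂ :=
  twistUnit r z ^ k * exp (((a * (k * ∑ j : Fin r, stripLog w (z - holeCentre r j)) : ℝ) : ℂ) * I)

/-- **The strip multiplier** `Π_j stripUnit k w (z - c_j)`: `k` full turns across the band above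
each hole. [cite: ManolescuMarengonSarkarWillis2023, §2.1] -/
def stripMultiplier (r : ℕ) (k : ℤ) (w : ℝ) (z : ℂ) : ℂ :=
  ∏ j : Fin r, stripUnit k w (z - holeCentre r j)

/-- **The strip twist** `(z, w) ↦ (z, w · Π_j stripUnit k w (z - c_j))`: `k` full twists inserted
across the band above each hole (in `S³`: `k` full twists of the strands through the disc spanned
by the top circle of each dotted circle's tube). [cite: ManolescuMarengonSarkarWillis2023, §2.1 and §2.3] -/
def stripTwist (r : ℕ) (k : ℤ) (w : ℝ) : 𝔼 4 → 𝔼 4 :=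
  fibreRot (stripMultiplier r k w)

/-- At `a = 0` the strip family is `u^k`. [folklore] -/
theorem stripFamily_zero (r : ℕ) (k : ℤ) (w : ℝ) :
    stripFamily r k w 0 = fun z ↦ twistUnit r z ^ k := by
  funext z
  simp [stripFamily]

/-- The strip multipliers are units away from the hole centres. [folklore] -/
theorem norm_stripFamily {z : ℂ} (hz : ∀ j : Fin r, z ≠ holeCentre r j) (k : ℤ) (w a : ℝ) :
    ‖stripFamily r k w a z‖ = 1 := by
  rw [stripFamily, norm_mul, norm_zpow, norm_twistUnit hz, one_zpow, one_mul,
    Complex.norm_exp_ofReal_mul_I]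

/-- **At `a = 1` the strip family is the strip multiplier** (off the hole centres):
`u^k · Π_j (stripUnit_j · u_j^{-k}) = Π_j stripUnit_j`. [folklore] -/
theorem stripFamily_one {z : ℂ} (hz : ∀ j : Fin r, z ≠ holeCentre r j) (k : ℤ) (w : ℝ) :
    stripFamily r k w 1 z = stripMultiplier r k w z := by
  have hzj : ∀ j : Fin r, z - holeCentre r j ≠ 0 := fun j ↦ sub_ne_zero.2 (hz j)
  rw [stripFamily, one_mul, Finset.mul_sum, Complex.ofReal_sum, Finset.sum_mul, Complex.exp_sum]
  simp_rw [exp_mul_stripLog (hzj _)]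
  rw [Finset.prod_mul_distrib, stripMultiplier, twistUnit, Finset.prod_zpow]
  simp_rw [zpow_neg]
  have hne : (∏ j : Fin r, (z - holeCentre r j) / ((‖z - holeCentre r j‖ : ℝ) : ℂ)) ^ k ≠ 0 :=
    zpow_ne_zero k (Finset.prod_ne_zero_iff.2 fun j _ ↦
      div_ne_zero (hzj j) (by exact_mod_cast norm_ne_zero_iff.2 (hzj j)))
  rw [mul_left_comm, mul_inv_cancel₀ hne, mul_one]

/-- **The strip family is jointly smooth in `(a, z)`** at every `z` of the planar domain
(`|z - c_j| ≥ 1` for all `j`; `0 < w < 1`). [folklore] -/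
theorem contDiffAt_stripFamily {z : ℂ} (hz1 : ∀ j : Fin r, (1 : ℝ) ≤ ‖z - holeCentre r j‖) (k : ℤ)
    {w : ℝ} (hw : 0 < w) (hw1 : w < 1) (a : ℝ) :
    ContDiffAt ℝ ∞ (uncurry (stripFamily r k w)) (a, z) := by
  have hz : ∀ j : Fin r, z ≠ holeCentre r j := fun j h ↦ by
    have := hz1 j
    rw [h, sub_self, norm_zero] at this
    exact absurd this (by norm_num)
  have hu : ContDiffAt ℝ ∞ (fun p : ℝ × ℂ ↦ twistUnit r p.2 ^ k) (a, z) :=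
    (contDiffAt_zpow_complex (twistUnit_ne_zero hz) k).comp (a, z)
      ((contDiffAt_twistUnit hz).comp (a, z) contDiffAt_snd)
  have hL : ContDiffAt ℝ ∞ (fun y : ℂ ↦ (k : ℝ) * ∑ j : Fin r, stripLog w (y - holeCentre r j)) z :=
    contDiffAt_const.mul (ContDiffAt.sum fun j _ ↦
      (contDiffAt_stripLog hw hw1 (hz1 j)).comp z (contDiffAt_id.sub contDiffAt_const))
  have hL2 := hL.comp (a, z) (contDiffAt_snd : ContDiffAt ℝ ∞ (Prod.snd : ℝ × ℂ → ℂ) (a, z))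
  have hph : ContDiffAt ℝ ∞
      (fun p : ℝ × ℂ ↦ p.1 * ((k : ℝ) * ∑ j : Fin r, stripLog w (p.2 - holeCentre r j))) (a, z) :=
    contDiffAt_fst.mul hL2
  have hexp : ContDiffAt ℝ ∞ (fun p : ℝ × ℂ ↦
      exp (((p.1 * ((k : ℝ) * ∑ j : Fin r, stripLog w (p.2 - holeCentre r j)) : ℝ) : ℂ) * I))
      (a, z) :=
    (Complex.contDiff_exp.contDiffAt).comp (a, z)
      (((Complex.ofRealCLM.contDiff.contDiffAt).comp (a, z) hph).mul contDiffAt_const)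
  exact hu.mul hexp

/-- **The strip multiplier is `1` off the bands**: at points `z` with, for every `j`,
`Im z ≤ 0` or `|Re z - c_j| ≥ w`. [folklore] -/
theorem stripMultiplier_eq_one {k : ℤ} {w : ℝ} (hw : 0 < w) {z : ℂ}
    (hoff : ∀ j : Fin r, z.im ≤ 0 ∨ w ≤ |z.re - (holeCentre r j).re|) :
    stripMultiplier r k w z = 1 := by
  refine Finset.prod_eq_one fun j _ ↦ stripUnit_eq_one hw ?_
  rcases hoff j with h | h
  · left; simpa [holeCentre] using h
  · right; simpa using h

/-- **The strip twist is the identity off the bands.** [cite: ManolescuMarengonSarkarWillis2023, §2.1] -/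
theorem stripTwist_eq_self {k : ℤ} {w : ℝ} (hw : 0 < w) {x : 𝔼 4}
    (hoff : ∀ j : Fin r, (zC x).im ≤ 0 ∨ w ≤ |(zC x).re - (holeCentre r j).re|) :
    stripTwist r k w x = x :=
  fibreRot_of_apply_eq_one (stripMultiplier_eq_one hw hoff)

/-- On a model knot the end of the strip family is the strip twist. [folklore] -/
theorem fibreRot_stripFamily_one_comp {K : 𝕊 1 → 𝔼 4} (hK : IsModelKnot r K) (k : ℤ) (w : ℝ) :
    fibreRot (stripFamily r k w 1) ∘ K = stripTwist r k w ∘ K := by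
  funext t
  have hz : ∀ j : Fin r, zC (K t) ≠ holeCentre r j := zC_ne_holeCentre (hK.mem t).1
  show fibreRot (stripFamily r k w 1) (K t) = fibreRot (stripMultiplier r k w) (K t)
  simp only [fibreRot, stripFamily_one hz]

/-- The guard as a bound on `|z - c_j|`. [folklore] -/
theorem one_le_norm_zC_sub_holeCentre {x : 𝔼 4} (hx : ∀ j : Fin r, (1 : ℝ) ≤ holeTerm r j x)
    (j : Fin r) : (1 : ℝ) ≤ ‖zC x - holeCentre r j‖ := by
  have h := hx j
  rw [holeTerm_eq_normSq, Complex.normSq_eq_norm_sq] at h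
  nlinarith [norm_nonneg (zC x - holeCentre r j)]

/-! ## The strip twist versus the sphere twist on model knots -/

/-- **`s₋` is invariant under the strip twist** (MMSW Thm. 2.8 for these Dehn twists).
[cite: ManolescuMarengonSarkarWillis2023, Thm. 2.8] -/
theorem hasSMinus_stripTwist_comp_iff {K : 𝕊 1 → 𝔼 4} (hK : IsModelKnot r K) (k : ℤ)
    {w : ℝ} (hw : 0 < w) (hw1 : w < 1) (s : ℤ) :
    HasSMinus r (stripTwist r k w ∘ K) s ↔ HasSMinus r K s := by
  have hz : ∀ t, ∀ j : Fin r, zC (K t) ≠ holeCentre r j := fun t ↦ zC_ne_holeCentre (hK.mem t).1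
  have h := hasSMinus_fibreRot_iff_of_family hK (Φ := stripFamily r k w)
    (fun a t ↦ contDiffAt_stripFamily (one_le_norm_zC_sub_holeCentre (hK.mem t).1) k hw hw1 a)
    (fun a t ↦ norm_stripFamily (hz t) k w a) s
  rw [stripFamily_zero, ← sphereTwist_eq_fibreRot, hasSMinus_sphereTwist_comp_iff,
    fibreRot_stripFamily_one_comp hK] at h
  exact h.symm

/-- **`s₊` is invariant under the strip twist.** [cite: ManolescuMarengonSarkarWillis2023, Thm. 2.8] -/
theorem hasSPlus_stripTwist_comp_iff {K : 𝕊 1 → 𝔼 4} (hK : IsModelKnot r K) (k : ℤ)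
    {w : ℝ} (hw : 0 < w) (hw1 : w < 1) (s : ℤ) :
    HasSPlus r (stripTwist r k w ∘ K) s ↔ HasSPlus r K s := by
  have hz : ∀ t, ∀ j : Fin r, zC (K t) ≠ holeCentre r j := fun t ↦ zC_ne_holeCentre (hK.mem t).1
  have hiso := (isSmoothModelIsotopy_fibreRot hK (Φ := stripFamily r k w)
    (fun a t ↦ contDiffAt_stripFamily (one_le_norm_zC_sub_holeCentre (hK.mem t).1) k hw hw1 a)
    (fun a t ↦ norm_stripFamily (hz t) k w a)).isModelIsotopic
  rw [stripFamily_zero, ← sphereTwist_eq_fibreRot, fibreRot_stripFamily_one_comp hK] at hiso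
  rw [← hiso.hasSPlus_iff s, hasSPlus_sphereTwist_comp_iff]

/-- **The finite approximations of `K` versus strip-twisted pictures**: for a core-missing model
knot, the Rasmussen invariants of `D(k⃗ + j⃗)(K)` are those of `D(j⃗)(stripTwist r k w ∘ K)`; in
particular (`j = 0`) `s(D(k⃗)(K)) = s(D(0⃗)(stripTwist_k ∘ K))`, the untwisted picture of the knot
with `k` full twists inserted across each band. [cite: ManolescuMarengonSarkarWillis2023, §2.1 and Prop. 8.2 (i)] -/
theorem approxHasRasmussen_iff_stripTwist {K : 𝕊 1 → 𝔼 4} (hK : IsModelKnot r K)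
    (hw : ∀ t, wC (K t) ≠ 0) (k : ℤ) {w : ℝ} (hw0 : 0 < w) (hw1 : w < 1) (j : ℤ) (s : ℤ) :
    ApproxHasRasmussen r (k + j) K s ↔ ApproxHasRasmussen r j (stripTwist r k w ∘ K) s := by
  have hz : ∀ t, ∀ j : Fin r, zC (K t) ≠ holeCentre r j := fun t ↦ zC_ne_holeCentre (hK.mem t).1
  rw [← fibreRot_stripFamily_one_comp hK]
  exact approxHasRasmussen_iff_fibreRot_of_family hK hw (Φ := stripFamily r k w)
    (fun a t ↦ contDiffAt_stripFamily (one_le_norm_zC_sub_holeCentre (hK.mem t).1) k hw0 hw1 a)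
    (fun a t ↦ norm_stripFamily (hz t) k w a) (stripFamily_zero r k w) j s

/-- **The eventual value through strip-twisted pictures**: `s₋(K) = s` as soon as the untwisted
pictures of the strip-twisted knots `stripTwist r k w ∘ K` have Rasmussen invariant `s` for all
large `k`. [cite: ManolescuMarengonSarkarWillis2023, Def. 8.1 and Prop. 8.2 (i)] -/
theorem hasSMinus_of_eventually_stripTwist {K : 𝕊 1 → 𝔼 4} (hK : IsModelKnot r K)
    (h0 : IsNullHomologous r K) (hw : ∀ t, wC (K t) ≠ 0) {w : ℝ} (hw0 : 0 < w) (hw1 : w < 1)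
    {s k₀ : ℤ} (h : ∀ k, k₀ ≤ k → ApproxHasRasmussen r 0 (stripTwist r k w ∘ K) s) :
    HasSMinus r K s := by
  refine ⟨h0, K, IsModelIsotopic.refl hK, hw, k₀, fun k hk ↦ ?_⟩
  have h' := h k hk
  rwa [← approxHasRasmussen_iff_stripTwist hK hw k hw0 hw1 0 s, add_zero] at h'


/-! ## Offset bands

The band above hole `j` may be displaced horizontally, `{|Re z - c_j - e_j| < w, Im z > 0}` with
`|e_j| + w < 1` (so that its lower edge still lies inside the hole): the strip unit is evaluated at
`z - c_j - e_j`, and the homotopy from `u^k` uses in addition the smooth argument of the direction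
quotient `(z - c_j)/(z - c_j - e_j)`, which avoids the negative real axis off the segment
`[c_j, c_j + e_j] ⊆ {|z - c_j| < 1}`.  This freedom is what general position with respect to the
bands requires (the band radii can then be chosen off the finitely many crossing radii and off
the critical values of the radius along the picture). -/

/-- **The strip logarithm is smooth off the closed band segment of the real axis**
(`Im ζ ≠ 0`, or `|Re ζ| > w`). [folklore] -/
theorem contDiffAt_stripLog_of_off_band {w : ℝ} (hw : 0 < w) {ζ : ℂ} (hζ : ζ.im ≠ 0 ∨ w < |ζ.re|) :
    ContDiffAt ℝ ∞ (stripLog w) ζ := by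
  have hband : ContDiff ℝ ∞ fun η : ℂ ↦ -(2 * π * bandStep w η.re) :=
    (contDiff_const.mul ((contDiff_bandStep w).comp Complex.reCLM.contDiff)).neg
  have hargneg : ∀ {η : ℂ}, -η ∈ slitPlane → ContDiffAt ℝ ∞ (fun η : ℂ ↦ arg (-η) + π) η :=
    fun h ↦ ((contDiffAt_arg_of_mem_slitPlane h).comp _ contDiff_neg.contDiffAt).add contDiffAt_const
  rcases lt_trichotomy ζ.im 0 with him | him | him
  · have hev : stripLog w =ᶠ[𝓝 ζ] fun η ↦ -(arg (-η) + π) := by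
      filter_upwards [(isOpen_lt Complex.continuous_im continuous_const).mem_nhds him] with η hη
      rw [stripLog, stripPhase, if_neg (not_lt.2 (le_of_lt hη)), zero_sub]
    refine ContDiffAt.congr_of_eventuallyEq ?_ hev
    exact (hargneg (by rw [Complex.mem_slitPlane_iff]; right; simp [him.ne])).neg
  · have hre : w < |ζ.re| := hζ.resolve_left (fun h ↦ h him)
    rcases lt_or_gt_of_ne (show ζ.re ≠ 0 from fun h0 ↦ by
      rw [h0, abs_zero] at hre; linarith) with hneg | hpos
    · have hlt : ζ.re < -w := by
        rw [abs_of_neg hneg] at hre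
        linarith
      have hev : stripLog w =ᶠ[𝓝 ζ] fun η ↦ -(arg (-η) + π) := by
        filter_upwards [(isOpen_lt Complex.continuous_re continuous_const).mem_nhds hlt] with η hη
        rw [stripLog, stripPhase]
        by_cases hi : 0 < η.im
        · rw [if_pos hi, bandStep_of_le_neg hw hη.le]
          ring
        · rw [if_neg hi, zero_sub]
      refine ContDiffAt.congr_of_eventuallyEq ?_ hev
      exact (hargneg (by rw [Complex.mem_slitPlane_iff]; left; simp; linarith)).neg
    · have hlt : w < ζ.re := by
        rw [abs_of_pos hpos] at hre
        linarith
      have hev : stripLog w =ᶠ[𝓝 ζ] fun η ↦ -(2 * π) - arg η := by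
        filter_upwards [(isOpen_lt continuous_const Complex.continuous_re).mem_nhds hlt] with η hη
        rw [stripLog, stripPhase]
        rcases lt_trichotomy η.im 0 with hi | hi | hi
        · rw [if_neg (not_lt.2 hi.le), Complex.arg_neg_eq_arg_add_pi_of_im_neg hi]
          ring
        · have hη' : η = ((η.re : ℝ) : ℂ) := by
            apply Complex.ext <;> simp [hi]
          have hpos' : 0 < η.re := lt_trans hw hη
          rw [if_neg (by rw [hi]; exact lt_irrefl 0), hη', ← Complex.ofReal_neg,
            Complex.arg_ofReal_of_neg (by linarith), Complex.arg_ofReal_of_nonneg hpos'.le]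
          ring
        · rw [if_pos hi, bandStep_of_le hw hη.le, Complex.arg_neg_eq_arg_sub_pi_of_im_pos hi]
          ring
      refine ContDiffAt.congr_of_eventuallyEq ?_ hev
      exact contDiffAt_const.sub (contDiffAt_arg_of_mem_slitPlane
        (by rw [Complex.mem_slitPlane_iff]; left; linarith))
  · have hev : stripLog w =ᶠ[𝓝 ζ] fun η ↦ -(2 * π * bandStep w η.re) - (arg (-η) + π) := by
      filter_upwards [(isOpen_lt continuous_const Complex.continuous_im).mem_nhds him] with η hη
      rw [stripLog, stripPhase, if_pos hη]
    refine ContDiffAt.congr_of_eventuallyEq ?_ hev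
    exact hband.contDiffAt.sub (hargneg (by rw [Complex.mem_slitPlane_iff]; right; simp [him.ne']))

/-- A point at distance `≥ 1` from `0`, displaced by `e` with `|e| + w < 1`, is off the closed band
segment: `Im ≠ 0` or `|Re - e| > w`. [folklore] -/
theorem off_band_of_one_le_norm {ζ : ℂ} (hζ : 1 ≤ ‖ζ‖) {e w : ℝ} (he : |e| + w < 1) :
    (ζ - e).im ≠ 0 ∨ w < |(ζ - e).re| := by
  by_cases him : ζ.im = 0
  · right
    have hre : ‖ζ‖ = |ζ.re| := by
      rw [Complex.norm_eq_sqrt_sq_add_sq, him]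
      simp [Real.sqrt_sq_eq_abs]
    rw [hre] at hζ
    have : |ζ.re| ≤ |ζ.re - e| + |e| := by
      have := abs_sub_abs_le_abs_sub ζ.re e
      linarith
    simp only [Complex.sub_re, Complex.ofReal_re]
    linarith
  · left
    simpa using him

/-- **The direction quotient `(ζ)/(ζ - e)` avoids the closed negative real axis** when `|ζ| ≥ 1`
and `|e| < 1` (it is negative real only on the segment strictly between `0` and `e`). [folklore] -/
theorem div_sub_mem_slitPlane {ζ : ℂ} (hζ : 1 ≤ ‖ζ‖) {e : ℝ} (he : |e| < 1) :
    ζ / (ζ - e) ∈ slitPlane := by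
  have hne : ζ - e ≠ 0 := by
    intro h
    have : ζ = e := sub_eq_zero.1 h
    rw [this, Complex.norm_real, Real.norm_eq_abs] at hζ
    linarith
  rw [Complex.mem_slitPlane_iff]
  by_contra hcon
  push Not at hcon
  obtain ⟨hre, him⟩ := hcon
  -- the quotient is a real number `q ≤ 0`
  set q : ℂ := ζ / (ζ - e) with hq
  have hqr : q = ((q.re : ℝ) : ℂ) := by
    apply Complex.ext <;> simp [him]
  have hζq : ζ = q * (ζ - e) := by rw [hq, div_mul_cancel₀ _ hne]
  -- so `(1 - q) ζ = -q e` with `1 - q ≥ 1`, i.e. `ζ = λ e`, `0 ≤ λ < 1`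
  have h1 : (1 - (q.re : ℂ)) * ζ = -(q.re : ℂ) * e := by
    have := hζq
    rw [hqr] at this
    linear_combination this
  have hpos : (0 : ℝ) < 1 - q.re := by linarith
  have hc : (1 : ℂ) - (q.re : ℂ) ≠ 0 := by
    have : ((1 - q.re : ℝ) : ℂ) ≠ 0 := by exact_mod_cast hpos.ne'
    simpa using this
  have hζeq : ζ = ((-q.re / (1 - q.re) : ℝ) : ℂ) * e := by
    apply mul_left_cancel₀ hc
    rw [h1]
    push_cast
    field_simp
  have hnorm : ‖ζ‖ = (-q.re / (1 - q.re)) * |e| := by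
    rw [hζeq, norm_mul, Complex.norm_real, Complex.norm_real, Real.norm_eq_abs, Real.norm_eq_abs,
      abs_of_nonneg (div_nonneg (by linarith) hpos.le)]
  have hlt : -q.re / (1 - q.re) < 1 := by
    rw [div_lt_one hpos]
    linarith
  have : ‖ζ‖ < 1 := by
    rw [hnorm]
    calc -q.re / (1 - q.re) * |e| ≤ -q.re / (1 - q.re) * 1 :=
          mul_le_mul_of_nonneg_left he.le (div_nonneg (by linarith) hpos.le)
      _ < 1 := by linarith
  linarith

/-- `e^{i arg q} · (ζ - e)/|ζ - e| = ζ/|ζ|` for the direction quotient `q = ζ/(ζ - e)`. [folklore] -/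
theorem exp_arg_div_sub_mul {ζ : ℂ} (hζ : ζ ≠ 0) {e : ℝ} (hne : ζ - e ≠ 0) :
    exp ((arg (ζ / (ζ - e)) : ℂ) * I) * ((ζ - e) / ((‖ζ - (e : ℂ)‖ : ℝ) : ℂ)) =
      ζ / ((‖ζ‖ : ℝ) : ℂ) := by
  have h := Complex.norm_mul_exp_arg_mul_I (ζ / (ζ - e))
  have hq : ζ / (ζ - e) ≠ 0 := div_ne_zero hζ hne
  have hqn : ((‖ζ / (ζ - ↑e)‖ : ℝ) : ℂ) ≠ 0 := by exact_mod_cast norm_ne_zero_iff.2 hq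
  have h1 : exp ((arg (ζ / (ζ - e)) : ℂ) * I) = (ζ / (ζ - e)) / ((‖ζ / (ζ - ↑e)‖ : ℝ) : ℂ) := by
    rw [eq_div_iff hqn, mul_comm, h]
  have hn1 : ((‖ζ‖ : ℝ) : ℂ) ≠ 0 := by exact_mod_cast norm_ne_zero_iff.2 hζ
  have hn2 : ((‖ζ - (e : ℂ)‖ : ℝ) : ℂ) ≠ 0 := by exact_mod_cast norm_ne_zero_iff.2 hne
  rw [h1, norm_div, Complex.ofReal_div]
  field_simp

/-- **The offset strip family** `Φ_a(z) = u(z)^k · e^{i a k Σ_j (stripLog w (z - c_j - e_j) -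
arg((z - c_j)/(z - c_j - e_j)))}`: from `u^k` to the offset strip multiplier. [folklore] -/
def stripFamilyAt (r : ℕ) (k : ℤ) (w : ℝ) (e : Fin r → ℝ) (a : ℝ) (z : ℂ) : ℂ :=
  twistUnit r z ^ k * exp (((a * (k * ∑ j : Fin r,
    (stripLog w (z - holeCentre r j - e j) -
      arg ((z - holeCentre r j) / (z - holeCentre r j - e j)))) : ℝ) : ℂ) * I)

/-- **The offset strip multiplier** `Π_j stripUnit k w (z - c_j - e_j)`.
[cite: ManolescuMarengonSarkarWillis2023, §2.1] -/
def stripMultiplierAt (r : ℕ) (k : ℤ) (w : ℝ) (e : Fin r → ℝ) (z : ℂ) : ℂ :=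
  ∏ j : Fin r, stripUnit k w (z - holeCentre r j - e j)

/-- **The offset strip twist**: `k` full twists across the band of half-width `w` centred at
`c_j + e_j` above each hole. [cite: ManolescuMarengonSarkarWillis2023, §2.1 and §2.3] -/
def stripTwistAt (r : ℕ) (k : ℤ) (w : ℝ) (e : Fin r → ℝ) : 𝔼 4 → 𝔼 4 :=
  fibreRot (stripMultiplierAt r k w e)

/-- At `a = 0` the offset strip family is `u^k`. [folklore] -/
theorem stripFamilyAt_zero (r : ℕ) (k : ℤ) (w : ℝ) (e : Fin r → ℝ) :
    stripFamilyAt r k w e 0 = fun z ↦ twistUnit r z ^ k := by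
  funext z
  simp [stripFamilyAt]

/-- The offset strip family consists of units away from the hole centres. [folklore] -/
theorem norm_stripFamilyAt {z : ℂ} (hz : ∀ j : Fin r, z ≠ holeCentre r j) (k : ℤ) (w : ℝ)
    (e : Fin r → ℝ) (a : ℝ) : ‖stripFamilyAt r k w e a z‖ = 1 := by
  rw [stripFamilyAt, norm_mul, norm_zpow, norm_twistUnit hz, one_zpow, one_mul,
    Complex.norm_exp_ofReal_mul_I]

/-- **At `a = 1` the offset strip family is the offset strip multiplier** (at points with
`|z - c_j| ≥ 1`, `|e_j| < 1`). [folklore] -/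
theorem stripFamilyAt_one {z : ℂ} (hz1 : ∀ j : Fin r, (1 : ℝ) ≤ ‖z - holeCentre r j‖) (k : ℤ)
    (w : ℝ) {e : Fin r → ℝ} (he : ∀ j, |e j| < 1) :
    stripFamilyAt r k w e 1 z = stripMultiplierAt r k w e z := by
  have hzj : ∀ j : Fin r, z - holeCentre r j ≠ 0 := fun j h ↦ by
    have := hz1 j
    rw [h, norm_zero] at this
    exact absurd this (by norm_num)
  have hzje : ∀ j : Fin r, z - holeCentre r j - e j ≠ 0 := fun j h ↦ by
    have h' : z - holeCentre r j = e j := sub_eq_zero.1 h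
    have := hz1 j
    rw [h', Complex.norm_real, Real.norm_eq_abs] at this
    linarith [he j]
  -- each summand exponentiates to `stripUnit_j · u_j^{-k}`
  have hterm : ∀ j : Fin r, exp (((k * (stripLog w (z - holeCentre r j - e j) -
      arg ((z - holeCentre r j) / (z - holeCentre r j - e j))) : ℝ) : ℂ) * I) =
      stripUnit k w (z - holeCentre r j - e j) *
        ((z - holeCentre r j) / ((‖z - holeCentre r j‖ : ℝ) : ℂ)) ^ (-k) := by
    intro j
    have hsplit : (((k * (stripLog w (z - holeCentre r j - e j) -
        arg ((z - holeCentre r j) / (z - holeCentre r j - e j))) : ℝ) : ℂ) * I) =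
        ((k * stripLog w (z - holeCentre r j - e j) : ℝ) : ℂ) * I +
          (-k : ℂ) * (((arg ((z - holeCentre r j) / (z - holeCentre r j - e j)) : ℝ) : ℂ) * I) := by
      push_cast
      ring
    rw [hsplit, Complex.exp_add, exp_mul_stripLog (hzje j),
      show (-(k : ℂ)) = ((-k : ℤ) : ℂ) by push_cast; ring, Complex.exp_int_mul, mul_assoc,
      ← mul_zpow]
    congr 2
    rw [mul_comm]
    exact exp_arg_div_sub_mul (hzj j) (hzje j)
  rw [stripFamilyAt, one_mul, Finset.mul_sum, Complex.ofReal_sum, Finset.sum_mul, Complex.exp_sum]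
  simp_rw [hterm]
  rw [Finset.prod_mul_distrib, stripMultiplierAt, twistUnit, Finset.prod_zpow]
  simp_rw [zpow_neg]
  have hne : (∏ j : Fin r, (z - holeCentre r j) / ((‖z - holeCentre r j‖ : ℝ) : ℂ)) ^ k ≠ 0 :=
    zpow_ne_zero k (Finset.prod_ne_zero_iff.2 fun j _ ↦
      div_ne_zero (hzj j) (by exact_mod_cast norm_ne_zero_iff.2 (hzj j)))
  rw [mul_left_comm, mul_inv_cancel₀ hne, mul_one]

/-- **The offset strip family is jointly smooth in `(a, z)`** at every `z` of the planar domain,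
for offsets with `|e_j| + w < 1`. [folklore] -/
theorem contDiffAt_stripFamilyAt {z : ℂ} (hz1 : ∀ j : Fin r, (1 : ℝ) ≤ ‖z - holeCentre r j‖)
    (k : ℤ) {w : ℝ} (hw : 0 < w) {e : Fin r → ℝ} (he : ∀ j, |e j| + w < 1) (a : ℝ) :
    ContDiffAt ℝ ∞ (uncurry (stripFamilyAt r k w e)) (a, z) := by
  have he1 : ∀ j, |e j| < 1 := fun j ↦ by linarith [he j]
  have hz : ∀ j : Fin r, z ≠ holeCentre r j := fun j h ↦ by
    have := hz1 j
    rw [h, sub_self, norm_zero] at this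
    exact absurd this (by norm_num)
  have hzje : ∀ j : Fin r, z - holeCentre r j - e j ≠ 0 := fun j h ↦ by
    have h' : z - holeCentre r j = e j := sub_eq_zero.1 h
    have := hz1 j
    rw [h', Complex.norm_real, Real.norm_eq_abs] at this
    linarith [he1 j]
  have hu : ContDiffAt ℝ ∞ (fun p : ℝ × ℂ ↦ twistUnit r p.2 ^ k) (a, z) :=
    (contDiffAt_zpow_complex (twistUnit_ne_zero hz) k).comp (a, z)
      ((contDiffAt_twistUnit hz).comp (a, z) contDiffAt_snd)
  -- the smooth summands
  have hsum : ∀ j : Fin r, ContDiffAt ℝ ∞ (fun y : ℂ ↦ stripLog w (y - holeCentre r j - e j) -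
      arg ((y - holeCentre r j) / (y - holeCentre r j - e j))) z := by
    intro j
    have hL : ContDiffAt ℝ ∞ (fun y : ℂ ↦ stripLog w (y - holeCentre r j - e j)) z := by
      have hoff := off_band_of_one_le_norm (hz1 j) (he j)
      have h := contDiffAt_stripLog_of_off_band hw (ζ := z - holeCentre r j - e j)
        (by simpa [sub_sub] using hoff)
      exact h.comp z ((contDiffAt_id.sub contDiffAt_const).sub contDiffAt_const)
    have hq : ContDiffAt ℝ ∞ (fun y : ℂ ↦ (y - holeCentre r j) / (y - holeCentre r j - e j)) z := by
      simp_rw [div_eq_mul_inv]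
      exact (contDiffAt_id.sub contDiffAt_const).mul
        (((contDiffAt_id.sub contDiffAt_const).sub contDiffAt_const).inv (hzje j))
    have hA : ContDiffAt ℝ ∞ (fun y : ℂ ↦ arg ((y - holeCentre r j) / (y - holeCentre r j - e j))) z := by
      have h := ContDiffAt.comp (g := arg) z
        (contDiffAt_arg_of_mem_slitPlane (div_sub_mem_slitPlane (hz1 j) (he1 j))) hq
      exact h
    exact hL.sub hA
  have hL : ContDiffAt ℝ ∞ (fun y : ℂ ↦ (k : ℝ) * ∑ j : Fin r, (stripLog w (y - holeCentre r j - e j) -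
      arg ((y - holeCentre r j) / (y - holeCentre r j - e j)))) z :=
    contDiffAt_const.mul (ContDiffAt.sum fun j _ ↦ hsum j)
  have hL2 := hL.comp (a, z) (contDiffAt_snd : ContDiffAt ℝ ∞ (Prod.snd : ℝ × ℂ → ℂ) (a, z))
  have hph : ContDiffAt ℝ ∞ (fun p : ℝ × ℂ ↦ p.1 * ((k : ℝ) * ∑ j : Fin r,
      (stripLog w (p.2 - holeCentre r j - e j) -
        arg ((p.2 - holeCentre r j) / (p.2 - holeCentre r j - e j))))) (a, z) :=
    contDiffAt_fst.mul hL2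
  have hexp : ContDiffAt ℝ ∞ (fun p : ℝ × ℂ ↦ exp (((p.1 * ((k : ℝ) * ∑ j : Fin r,
      (stripLog w (p.2 - holeCentre r j - e j) -
        arg ((p.2 - holeCentre r j) / (p.2 - holeCentre r j - e j)))) : ℝ) : ℂ) * I)) (a, z) :=
    (Complex.contDiff_exp.contDiffAt).comp (a, z)
      (((Complex.ofRealCLM.contDiff.contDiffAt).comp (a, z) hph).mul contDiffAt_const)
  exact hu.mul hexp

/-- **The offset strip multiplier is `1` off the bands.** [folklore] -/
theorem stripMultiplierAt_eq_one {k : ℤ} {w : ℝ} (hw : 0 < w) {e : Fin r → ℝ} {z : ℂ}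
    (hoff : ∀ j : Fin r, z.im ≤ 0 ∨ w ≤ |z.re - (holeCentre r j).re - e j|) :
    stripMultiplierAt r k w e z = 1 := by
  refine Finset.prod_eq_one fun j _ ↦ stripUnit_eq_one hw ?_
  rcases hoff j with h | h
  · left; simpa [holeCentre] using h
  · right; simpa using h

/-- **The offset strip twist is the identity off the bands.** [folklore] -/
theorem stripTwistAt_eq_self {k : ℤ} {w : ℝ} (hw : 0 < w) {e : Fin r → ℝ} {x : 𝔼 4}
    (hoff : ∀ j : Fin r, (zC x).im ≤ 0 ∨ w ≤ |(zC x).re - (holeCentre r j).re - e j|) :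
    stripTwistAt r k w e x = x :=
  fibreRot_of_apply_eq_one (stripMultiplierAt_eq_one hw hoff)

/-- On a model knot the end of the offset strip family is the offset strip twist. [folklore] -/
theorem fibreRot_stripFamilyAt_one_comp {K : 𝕊 1 → 𝔼 4} (hK : IsModelKnot r K) (k : ℤ) (w : ℝ)
    {e : Fin r → ℝ} (he : ∀ j, |e j| < 1) :
    fibreRot (stripFamilyAt r k w e 1) ∘ K = stripTwistAt r k w e ∘ K := by
  funext t
  show fibreRot (stripFamilyAt r k w e 1) (K t) = fibreRot (stripMultiplierAt r k w e) (K t)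
  simp only [fibreRot, stripFamilyAt_one (one_le_norm_zC_sub_holeCentre (hK.mem t).1) k w he]

/-- **`s₋` is invariant under the offset strip twist.** [cite: ManolescuMarengonSarkarWillis2023, Thm. 2.8] -/
theorem hasSMinus_stripTwistAt_comp_iff {K : 𝕊 1 → 𝔼 4} (hK : IsModelKnot r K) (k : ℤ)
    {w : ℝ} (hw : 0 < w) {e : Fin r → ℝ} (he : ∀ j, |e j| + w < 1) (s : ℤ) :
    HasSMinus r (stripTwistAt r k w e ∘ K) s ↔ HasSMinus r K s := by
  have he1 : ∀ j, |e j| < 1 := fun j ↦ by linarith [he j]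
  have hz : ∀ t, ∀ j : Fin r, zC (K t) ≠ holeCentre r j := fun t ↦ zC_ne_holeCentre (hK.mem t).1
  have h := hasSMinus_fibreRot_iff_of_family hK (Φ := stripFamilyAt r k w e)
    (fun a t ↦ contDiffAt_stripFamilyAt (one_le_norm_zC_sub_holeCentre (hK.mem t).1) k hw he a)
    (fun a t ↦ norm_stripFamilyAt (hz t) k w e a) s
  rw [stripFamilyAt_zero, ← sphereTwist_eq_fibreRot, hasSMinus_sphereTwist_comp_iff,
    fibreRot_stripFamilyAt_one_comp hK k w he1] at h
  exact h.symm

/-- **`s₊` is invariant under the offset strip twist.** [cite: ManolescuMarengonSarkarWillis2023, Thm. 2.8] -/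
theorem hasSPlus_stripTwistAt_comp_iff {K : 𝕊 1 → 𝔼 4} (hK : IsModelKnot r K) (k : ℤ)
    {w : ℝ} (hw : 0 < w) {e : Fin r → ℝ} (he : ∀ j, |e j| + w < 1) (s : ℤ) :
    HasSPlus r (stripTwistAt r k w e ∘ K) s ↔ HasSPlus r K s := by
  have he1 : ∀ j, |e j| < 1 := fun j ↦ by linarith [he j]
  have hz : ∀ t, ∀ j : Fin r, zC (K t) ≠ holeCentre r j := fun t ↦ zC_ne_holeCentre (hK.mem t).1
  have hiso := (isSmoothModelIsotopy_fibreRot hK (Φ := stripFamilyAt r k w e)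
    (fun a t ↦ contDiffAt_stripFamilyAt (one_le_norm_zC_sub_holeCentre (hK.mem t).1) k hw he a)
    (fun a t ↦ norm_stripFamilyAt (hz t) k w e a)).isModelIsotopic
  rw [stripFamilyAt_zero, ← sphereTwist_eq_fibreRot, fibreRot_stripFamilyAt_one_comp hK k w he1]
    at hiso
  rw [← hiso.hasSPlus_iff s, hasSPlus_sphereTwist_comp_iff]

/-- **The finite approximations versus offset-strip-twisted pictures**:
`s(D(k⃗ + j⃗)(K)) = s(D(j⃗)(stripTwistAt r k w e ∘ K))` for a core-missing model knot.
[cite: ManolescuMarengonSarkarWillis2023, §2.1 and Prop. 8.2 (i)] -/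
theorem approxHasRasmussen_iff_stripTwistAt {K : 𝕊 1 → 𝔼 4} (hK : IsModelKnot r K)
    (hw : ∀ t, wC (K t) ≠ 0) (k : ℤ) {w : ℝ} (hw0 : 0 < w) {e : Fin r → ℝ}
    (he : ∀ j, |e j| + w < 1) (j : ℤ) (s : ℤ) :
    ApproxHasRasmussen r (k + j) K s ↔ ApproxHasRasmussen r j (stripTwistAt r k w e ∘ K) s := by
  have he1 : ∀ j, |e j| < 1 := fun j ↦ by linarith [he j]
  have hz : ∀ t, ∀ j : Fin r, zC (K t) ≠ holeCentre r j := fun t ↦ zC_ne_holeCentre (hK.mem t).1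
  rw [← fibreRot_stripFamilyAt_one_comp hK k w he1]
  exact approxHasRasmussen_iff_fibreRot_of_family hK hw (Φ := stripFamilyAt r k w e)
    (fun a t ↦ contDiffAt_stripFamilyAt (one_le_norm_zC_sub_holeCentre (hK.mem t).1) k hw0 he a)
    (fun a t ↦ norm_stripFamilyAt (hz t) k w e a) (stripFamilyAt_zero r k w e) j s

end MMSW

end Literature.Topology.FourManifolds

end
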